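import Summits.QuantumFields.BalabanUV.Beta.GAN24.LayerPushEntry
import Summits.QuantumFields.BalabanUV.Beta.GAN24.LatticeFreeze

/-!
# `BalabanUV.Beta.GAN24.LayerPushFrozenSlice` — binder row G-an2-4 / (CONV-C), W-slot CT-W, route «WC-TL» ∕ «QR-LL» (gan24-p1 g25 `gen25/QR-DESIGN-v0.md` §3, RULINGS
# R-gan24p1-g25-2 (3) and R-gan24p1-g25-11 «(LT-1″): the count for a zero-charge ∕ difference-form shell letter, with the dipole identity putting the difference on the
# legs»), row **(LT-Δ) «LAYER TRANSPORT»**, part (LT-1″a) — ONE KERNEL LOCALISED AT A BASE POINT: the two-leg sandwich equals its FROZEN CHARGE TERM up to a remainder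
# carrying exactly ONE Lipschitz allowance of a kernel leg (part (LT-1″b) = `GAN24/LayerPushFrozen`: the weighted family, the slot outermost, the commutator's charge)

NOT IN PRINT; OUR BOOKKEEPING ([folklore] real analysis on `ℤ^{d+1}` over leaf-12's `LatticeFreeze` bricks (`abs_tsum_mul_sub_frozen_le`, `abs_sub_le_of_unit_steps`), leaf-03's
`Push4TwoRate.l1_quo_sub_quo_le_l1` and one product-dominated Fubini (`KernelWard.tsum_comm_of_prodBound`) — the ONE-SLOT, THREE-LEG twin of road W3's (T-irr) core
`Push4Frozen` ∕ `Push4Irr` (leaf-12, p213474 lineage), written for leaf-01 g43's `Push3.push₃` carrier; G-an2-4 formalisation swarm, leaf prover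
`b2b-balaban-gan24-formalise-leaf-01`, gen 63).  HONEST FRAMING (cell contract, verbatim): «discharging `BetaPertH` makes Bałaban's UV stability UNCONDITIONAL — a real constructive-QFT result; it is NOT the
continuum limit and NOT the Clay problem.»  HONEST DEPENDENCY (verbatim): «continuum YM on T⁴ ⇐ BetaPertH ∧ nine spine estimates (0/9 proved); BetaPertH ⇐ (D1) ∧ (D4) ∧
CAP+tail; G-an2-4 gates asym, D1 and NE2/3/4.»

## What (generic `d`; no object of an2's typed system occurs)
§0 coarse envelopes seen from a base point `u` (`quo` is 1-Lipschitz): `exp_wobble`, `leg_rel_sup` (`|f k x| ≤ (A·e^{−κ‖quo N u − c‖₁})·e^{κ‖x−u‖₁}`), `leg_rel_lip`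
   (a coarse UNIT-GRADIENT envelope `A′` ⇒ Lipschitz from `u` along lattice paths with the same relative constant).
§1 for a kernel `K` with `|K x z (inl κ₁) (inl κ₂)| ≤ B·e^{−m(‖x−u‖₁+‖z−u‖₁)}` and two kernel legs `lx κ₁ x`, `rz κ₂ z` given by sup ∕ Lipschitz allowances `(pl, ql)`,
   `(pr, qr)` relative to `u` with growth rate `κ < m`:
   **`abs_sand_sub_frozen_le`**: `|Σ'_z Σ_{κ₂} (Σ'_x Σ_{κ₁} lx κ₁ x·K x z κ₁ κ₂)·rz κ₂ z − Σ_{κ₂ κ₁} lx κ₁ u·rz κ₂ u·(Σ'_x Σ'_z K x z κ₁ κ₂)|`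
   `≤ (d+1)²·B·M₁·(qr·pl·Zl(m−κ) + pr·ql·Zl m)`, `M₁ := (2∕(m−κ))·Zl((m−κ)∕2)` — the legs FROZEN at the base point against the kernel's field–field CHARGE
   `Σ'_x Σ'_z K x z κ₁ κ₂`, every remainder carrying exactly ONE of `ql, qr` (one Taylor order); sizes `abs_sand_le`, `abs_frozen_le` (for summability downstream);
   layers `abs_xlayer_le`, `abs_xlayer_sub_frozen_le`, `abs_G_le`, `absK_le`.
[folklore]; 0 cited facts, 0 `def`, 0 `def … : Prop`, 0 sorry.  Asserts NOTHING about an2's towers, about which letters of QR-LL are charge-free, or about K-LL-3; NEVER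
«G-an2-4 closed» as (CONV-C); NOT D1, NOT `BetaPertH`, NOT continuum, NOT Clay.  2026-08-22.
-/

noncomputable section

open Finset
open scoped BigOperators
open Literature.MathematicalPhysics.QuantumFieldTheory
open Literature.MathematicalPhysics.QuantumFieldTheory.Balaban1983to89
open Literature.MathematicalPhysics.QuantumFieldTheory.Balaban1983to89.Beta
open B12Sec2to5 (l1 l1_nonneg)
open ExpKernelCalculus (MKer Decays comp Zl Zl_nonneg Zl_pos summable_exp_shift summable_exp_shift' tsum_exp_shift' l1_sub_triangle l1_sub_symm)
open OneStepResolventKernel (Fib wsum)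
open LatticeForm (quo)
open KernelWard (ProdBound tsum_comm_of_prodBound)
open Summit.QuantumFields.BalabanUV.Beta.GAN24.Push4TwoRate (l1_quo_sub_quo_le_l1)
open Summit.QuantumFields.BalabanUV.Beta.GAN24.LatticeFreeze (summable_mul_of_env abs_tsum_mul_le_of_env abs_tsum_mul_sub_frozen_le abs_sub_le_of_unit_steps)
open Summit.QuantumFields.BalabanUV.Beta.GAN24.LayerPushEntry (abs_tsum_le_tsum_of_abs_le)

namespace Summit.QuantumFields.BalabanUV.Beta.GAN24.LayerPushFrozenSlice

variable {d : ℕ}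

/-! ## §0 Coarse envelopes seen from a base point -/

/-- [folklore] **BLOCK-LABEL WOBBLE in `ℓ¹` currency**: `e^{−κ‖quo N x − c‖₁} ≤ e^{κ‖x − u‖₁}·e^{−κ‖quo N u − c‖₁}` (`quo` is 1-Lipschitz, `N ≥ 1`). -/
theorem exp_wobble {N : ℕ} (hN : 1 ≤ N) {κ : ℝ} (hκ : 0 ≤ κ) (x u c : Fin (d + 1) → ℤ) :
    Real.exp (-κ * l1 (quo N x - c)) ≤ Real.exp (κ * l1 (x - u)) * Real.exp (-κ * l1 (quo N u - c)) := by
  rw [← Real.exp_add, Real.exp_le_exp]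
  have h1 : l1 (quo N u - quo N x) ≤ l1 (u - x) := l1_quo_sub_quo_le_l1 hN u x
  have h2 : l1 (quo N u - c) ≤ l1 (quo N u - quo N x) + l1 (quo N x - c) := l1_sub_triangle _ _ _
  rw [l1_sub_symm u x] at h1
  nlinarith

/-- [folklore] A leg with a coarse envelope, seen from the base point `u`: `|f k x| ≤ (A·e^{−κ‖quo N u − c‖₁})·e^{κ‖x − u‖₁}`. -/
theorem leg_rel_sup {N : ℕ} (hN : 1 ≤ N) {κ A : ℝ} (hκ : 0 ≤ κ) (hA : 0 ≤ A) {f : Fin (d + 1) → (Fin (d + 1) → ℤ) → ℝ}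
    {c : Fin (d + 1) → ℤ} (hf : ∀ k x, |f k x| ≤ A * Real.exp (-κ * l1 (quo N x - c))) (u : Fin (d + 1) → ℤ) (k : Fin (d + 1))
    (x : Fin (d + 1) → ℤ) : |f k x| ≤ A * Real.exp (-κ * l1 (quo N u - c)) * Real.exp (κ * l1 (x - u)) := by
  calc |f k x| ≤ A * Real.exp (-κ * l1 (quo N x - c)) := hf k x
    _ ≤ A * (Real.exp (κ * l1 (x - u)) * Real.exp (-κ * l1 (quo N u - c))) := mul_le_mul_of_nonneg_left (exp_wobble hN hκ x u c) hA
    _ = _ := by ring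

/-- [folklore] A leg with a coarse UNIT-GRADIENT envelope, seen from the base point `u`: Lipschitz along lattice paths,
`|f k x − f k u| ≤ (A′·e^{−κ‖quo N u − c‖₁})·‖x − u‖₁·e^{κ‖x − u‖₁}` (`LatticeFreeze.abs_sub_le_of_unit_steps`). -/
theorem leg_rel_lip {N : ℕ} (hN : 1 ≤ N) {κ A' : ℝ} (hκ : 0 ≤ κ) (hA' : 0 ≤ A') {f : Fin (d + 1) → (Fin (d + 1) → ℤ) → ℝ}
    {c : Fin (d + 1) → ℤ} (hf' : ∀ k x i, |f k (x + Pi.single i 1) - f k x| ≤ A' * Real.exp (-κ * l1 (quo N x - c)))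
    (u : Fin (d + 1) → ℤ) (k : Fin (d + 1)) (x : Fin (d + 1) → ℤ) :
    |f k x - f k u| ≤ A' * Real.exp (-κ * l1 (quo N u - c)) * l1 (x - u) * Real.exp (κ * l1 (x - u)) := by
  refine abs_sub_le_of_unit_steps (f := f k) (u := u) (by positivity) hκ (fun p i => ?_) x
  calc |f k (p + Pi.single i 1) - f k p| ≤ A' * Real.exp (-κ * l1 (quo N p - c)) := hf' k p i
    _ ≤ A' * (Real.exp (κ * l1 (p - u)) * Real.exp (-κ * l1 (quo N u - c))) := mul_le_mul_of_nonneg_left (exp_wobble hN hκ p u c) hA'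
    _ = A' * Real.exp (-κ * l1 (quo N u - c)) * Real.exp (κ * l1 (p - u)) := by ring

/-! ## §1 One kernel localised at a base point: the two-leg sandwich equals its FROZEN CHARGE TERM up to one Lipschitz allowance -/

section Sandwich

variable {lx rz : Fin (d + 1) → (Fin (d + 1) → ℤ) → ℝ} {K : MKer (d + 1) (Fib d)} {u : Fin (d + 1) → ℤ} {B m κ pl ql pr qr : ℝ}
  (hm : κ < m) (hκ : 0 ≤ κ) (hB : 0 ≤ B) (hpl : 0 ≤ pl) (hql : 0 ≤ ql) (hpr : 0 ≤ pr) (hqr : 0 ≤ qr)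
  (hK : ∀ x z κ₁ κ₂, |K x z (Sum.inl κ₁) (Sum.inl κ₂)| ≤ B * Real.exp (-m * (l1 (x - u) + l1 (z - u))))
  (hl : ∀ κ₁ x, |lx κ₁ x| ≤ pl * Real.exp (κ * l1 (x - u)))
  (hl' : ∀ κ₁ x, |lx κ₁ x - lx κ₁ u| ≤ ql * l1 (x - u) * Real.exp (κ * l1 (x - u)))
  (hr : ∀ κ₂ z, |rz κ₂ z| ≤ pr * Real.exp (κ * l1 (z - u)))
  (hr' : ∀ κ₂ z, |rz κ₂ z - rz κ₂ u| ≤ qr * l1 (z - u) * Real.exp (κ * l1 (z - u)))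

/-- [folklore] The kernel's envelope, split. -/
theorem absK_le (hK : ∀ x z κ₁ κ₂, |K x z (Sum.inl κ₁) (Sum.inl κ₂)| ≤ B * Real.exp (-m * (l1 (x - u) + l1 (z - u))))
    (x z : Fin (d + 1) → ℤ) (κ₁ κ₂ : Fin (d + 1)) :
    |K x z (Sum.inl κ₁) (Sum.inl κ₂)| ≤ (B * Real.exp (-m * l1 (z - u))) * Real.exp (-m * l1 (x - u)) := by
  refine (hK x z κ₁ κ₂).trans (le_of_eq ?_)
  rw [mul_add, Real.exp_add]; ring

include hm hpl hK hl in
/-- [folklore] **THE `x`-LAYER**: `|Σ'_x lx κ₁ x · K x z κ₁ κ₂| ≤ pl·B·Zl(m−κ)·e^{−m‖z−u‖₁}` and its summability. -/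
theorem abs_xlayer_le (z : Fin (d + 1) → ℤ) (κ₁ κ₂ : Fin (d + 1)) :
    (Summable fun x => lx κ₁ x * K x z (Sum.inl κ₁) (Sum.inl κ₂)) ∧
    |∑' x, lx κ₁ x * K x z (Sum.inl κ₁) (Sum.inl κ₂)| ≤ pl * (B * Real.exp (-m * l1 (z - u))) * Zl (d + 1) (m - κ) := by
  have hφ : ∀ x, |K x z (Sum.inl κ₁) (Sum.inl κ₂)| ≤ (B * Real.exp (-m * l1 (z - u))) * Real.exp (-m * l1 (x - u)) :=
    fun x => absK_le hK x z κ₁ κ₂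
  have hw : ∀ x, |lx κ₁ x| ≤ pl * Real.exp (κ * l1 (x - u)) * 1 := fun x => by rw [mul_one]; exact hl κ₁ x
  refine ⟨summable_mul_of_env hm hpl zero_le_one hw hφ, ?_⟩
  have h := abs_tsum_mul_le_of_env hm hpl zero_le_one hw hφ
  rw [mul_one] at h
  exact h

include hm hκ hpl hql hK hl hl' in
/-- [folklore] **FREEZE THE LEFT LEG at `u` inside the `x`-layer**: `|Σ'_x lx κ₁ x·K x z − lx κ₁ u·Σ'_x K x z| ≤ ql·B·e^{−m‖z−u‖₁}·M₁`,
`M₁ := (2∕(m−κ))·Zl((m−κ)∕2)`. -/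
theorem abs_xlayer_sub_frozen_le (z : Fin (d + 1) → ℤ) (κ₁ κ₂ : Fin (d + 1)) :
    |∑' x, lx κ₁ x * K x z (Sum.inl κ₁) (Sum.inl κ₂) - lx κ₁ u * ∑' x, K x z (Sum.inl κ₁) (Sum.inl κ₂)|
      ≤ ql * (B * Real.exp (-m * l1 (z - u))) * (2 / (m - κ) * Zl (d + 1) ((m - κ) / 2)) := by
  have hφ : ∀ x, |K x z (Sum.inl κ₁) (Sum.inl κ₂)| ≤ (B * Real.exp (-m * l1 (z - u))) * Real.exp (-m * l1 (x - u)) :=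
    fun x => absK_le hK x z κ₁ κ₂
  have hw' : ∀ x, |lx κ₁ x - lx κ₁ u| ≤ ql * l1 (x - u) * Real.exp (κ * l1 (x - u)) * 1 := fun x => by rw [mul_one]; exact hl' κ₁ x
  have h := abs_tsum_mul_sub_frozen_le hm hκ hql zero_le_one hw' hφ (abs_xlayer_le hm hpl hK hl z κ₁ κ₂).1
  rw [mul_one] at h
  exact h

include hm hpl hK hl in
/-- [folklore] **THE `z`-PROFILE OF THE `x`-LAYER SUMMED OVER `κ₁`**: `|Σ_{κ₁} Σ'_x lx κ₁ x·K x z κ₁ κ₂| ≤ (d+1)·pl·B·Zl(m−κ)·e^{−m‖z−u‖₁}`. -/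
theorem abs_G_le (z : Fin (d + 1) → ℤ) (κ₂ : Fin (d + 1)) :
    |∑ κ₁ : Fin (d + 1), ∑' x, lx κ₁ x * K x z (Sum.inl κ₁) (Sum.inl κ₂)|
      ≤ (((d : ℝ) + 1) * (pl * B * Zl (d + 1) (m - κ))) * Real.exp (-m * l1 (z - u)) := by
  calc |∑ κ₁ : Fin (d + 1), ∑' x, lx κ₁ x * K x z (Sum.inl κ₁) (Sum.inl κ₂)|
      ≤ ∑ κ₁ : Fin (d + 1), |∑' x, lx κ₁ x * K x z (Sum.inl κ₁) (Sum.inl κ₂)| := Finset.abs_sum_le_sum_abs _ _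
    _ ≤ ∑ _κ₁ : Fin (d + 1), pl * (B * Real.exp (-m * l1 (z - u))) * Zl (d + 1) (m - κ) :=
        Finset.sum_le_sum fun κ₁ _ => (abs_xlayer_le hm hpl hK hl z κ₁ κ₂).2
    _ = _ := by rw [Finset.sum_const, Finset.card_univ, Fintype.card_fin, nsmul_eq_mul]; push_cast; ring

include hm hκ hB hpl hql hpr hqr hK hl hl' hr hr' in
/-- NOT IN PRINT; OUR BOOKKEEPING ([folklore] two freezings by `LatticeFreeze.abs_tsum_mul_sub_frozen_le`, one product-dominated Fubini).
**THE TWO-LEG SANDWICH OF A KERNEL LOCALISED AT `u` EQUALS ITS FROZEN CHARGE TERM UP TO ONE LIPSCHITZ ALLOWANCE**: with legs given by sup ∕ Lipschitz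
allowances `(pl, ql)`, `(pr, qr)` relative to `u` (growth rate `κ`) and `|K x z κ₁ κ₂| ≤ B·e^{−m(‖x−u‖₁+‖z−u‖₁)}`, `0 ≤ κ < m`,
`|Σ'_z Σ_{κ₂} (Σ'_x Σ_{κ₁} lx κ₁ x·K x z κ₁ κ₂)·rz κ₂ z − Σ_{κ₂} Σ_{κ₁} lx κ₁ u·rz κ₂ u·(Σ'_x Σ'_z K x z κ₁ κ₂)|`
`≤ (d+1)²·B·M₁·(qr·pl·Zl(m−κ) + pr·ql·Zl m)`, `M₁ := (2∕(m−κ))·Zl((m−κ)∕2)` — every remainder carries exactly ONE of `ql, qr`. -/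
theorem abs_sand_sub_frozen_le :
    |(∑' z, ∑ κ₂ : Fin (d + 1), (∑' x, ∑ κ₁ : Fin (d + 1), lx κ₁ x * K x z (Sum.inl κ₁) (Sum.inl κ₂)) * rz κ₂ z)
        - ∑ κ₂ : Fin (d + 1), ∑ κ₁ : Fin (d + 1), lx κ₁ u * rz κ₂ u * ∑' x, ∑' z, K x z (Sum.inl κ₁) (Sum.inl κ₂)|
      ≤ ((d : ℝ) + 1) ^ 2 * B * (2 / (m - κ) * Zl (d + 1) ((m - κ) / 2)) *
          (qr * pl * Zl (d + 1) (m - κ) + pr * ql * Zl (d + 1) m) := by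
  have hm0 : 0 < m := hκ.trans_lt hm
  have hmk : 0 < m - κ := sub_pos.2 hm
  have hZ1 : 0 ≤ Zl (d + 1) (m - κ) := Zl_nonneg hmk
  have hZm : 0 ≤ Zl (d + 1) m := Zl_nonneg hm0
  have hM₁ : 0 ≤ 2 / (m - κ) * Zl (d + 1) ((m - κ) / 2) := by have := Zl_nonneg (D := d + 1) (half_pos hmk); positivity
  -- abbreviations
  set Kf : (Fin (d + 1) → ℤ) → (Fin (d + 1) → ℤ) → Fin (d + 1) → Fin (d + 1) → ℝ :=
    fun x z κ₁ κ₂ => K x z (Sum.inl κ₁) (Sum.inl κ₂) with hKf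
  set G : (Fin (d + 1) → ℤ) → Fin (d + 1) → ℝ := fun z κ₂ => ∑ κ₁ : Fin (d + 1), ∑' x, lx κ₁ x * Kf x z κ₁ κ₂ with hG
  set BG : ℝ := ((d : ℝ) + 1) * (pl * B * Zl (d + 1) (m - κ)) with hBG
  have hBG0 : 0 ≤ BG := by rw [hBG]; positivity
  have hGle : ∀ z κ₂, |G z κ₂| ≤ BG * Real.exp (-m * l1 (z - u)) := fun z κ₂ => abs_G_le hm hpl hK hl z κ₂
  -- (0) the `x`-layer: finite sum inside the series ↔ outside
  have hx : ∀ z κ₂, (∑' x, ∑ κ₁ : Fin (d + 1), lx κ₁ x * Kf x z κ₁ κ₂) = G z κ₂ := by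
    intro z κ₂
    rw [hG]
    exact Summable.tsum_finsetSum fun κ₁ _ => (abs_xlayer_le hm hpl hK hl z κ₁ κ₂).1
  -- (i) the `z`-series: finite sum over `κ₂` outside
  have hzs : ∀ κ₂, Summable fun z => rz κ₂ z * G z κ₂ := fun κ₂ =>
    summable_mul_of_env (u := u) hm hpr zero_le_one (fun z => by rw [mul_one]; exact hr κ₂ z) (hGle · κ₂)
  have hT0 : (∑' z, ∑ κ₂ : Fin (d + 1), (∑' x, ∑ κ₁ : Fin (d + 1), lx κ₁ x * Kf x z κ₁ κ₂) * rz κ₂ z)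
      = ∑ κ₂ : Fin (d + 1), ∑' z, rz κ₂ z * G z κ₂ := by
    have e : ∀ z, (∑ κ₂ : Fin (d + 1), (∑' x, ∑ κ₁ : Fin (d + 1), lx κ₁ x * Kf x z κ₁ κ₂) * rz κ₂ z)
        = ∑ κ₂ : Fin (d + 1), rz κ₂ z * G z κ₂ := fun z => Finset.sum_congr rfl fun κ₂ _ => by rw [hx z κ₂, mul_comm]
    rw [tsum_congr e]
    exact Summable.tsum_finsetSum fun κ₂ _ => hzs κ₂
  -- (ii) freeze the right leg at `u`, per `κ₂`
  have hC : ∀ κ₂, |∑' z, rz κ₂ z * G z κ₂ - rz κ₂ u * ∑' z, G z κ₂| ≤ qr * 1 * BG * (2 / (m - κ) * Zl (d + 1) ((m - κ) / 2)) :=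
    fun κ₂ => abs_tsum_mul_sub_frozen_le hm hκ hqr zero_le_one (fun z => by rw [mul_one]; exact hr' κ₂ z) (hGle · κ₂) (hzs κ₂)
  -- (iii) inside: the `z`-series of the `x`-layer, finite sum over `κ₁` outside, and the left leg frozen at `u`
  have hzx : ∀ κ₁ κ₂, Summable fun z => ∑' x, lx κ₁ x * Kf x z κ₁ κ₂ := by
    intro κ₁ κ₂
    refine Summable.of_norm_bounded ((summable_exp_shift' hm0 u).mul_left (pl * B * Zl (d + 1) (m - κ))) fun z => ?_
    rw [Real.norm_eq_abs]
    refine (abs_xlayer_le hm hpl hK hl z κ₁ κ₂).2.trans (le_of_eq ?_); ring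
  have hGz : ∀ κ₂, (∑' z, G z κ₂) = ∑ κ₁ : Fin (d + 1), ∑' z, ∑' x, lx κ₁ x * Kf x z κ₁ κ₂ := by
    intro κ₂
    rw [hG]
    exact Summable.tsum_finsetSum fun κ₁ _ => hzx κ₁ κ₂
  have hKz : ∀ κ₁ κ₂, Summable fun z => ∑' x, Kf x z κ₁ κ₂ := by
    intro κ₁ κ₂
    refine Summable.of_norm_bounded ((summable_exp_shift' hm0 u).mul_left (B * Zl (d + 1) m)) fun z => ?_
    rw [Real.norm_eq_abs]
    have hb := abs_tsum_le_tsum_of_abs_le (fun x => absK_le hK x z κ₁ κ₂) ((summable_exp_shift' hm0 u).mul_left _)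
    refine hb.trans (le_of_eq ?_)
    rw [tsum_mul_left, tsum_exp_shift']; ring
  have hB' : ∀ κ₁ κ₂, |(∑' z, ∑' x, lx κ₁ x * Kf x z κ₁ κ₂) - lx κ₁ u * ∑' z, ∑' x, Kf x z κ₁ κ₂|
      ≤ ql * B * (2 / (m - κ) * Zl (d + 1) ((m - κ) / 2)) * Zl (d + 1) m := by
    intro κ₁ κ₂
    rw [← tsum_mul_left, ← Summable.tsum_sub (hzx κ₁ κ₂) ((hKz κ₁ κ₂).mul_left _)]
    have hpt : ∀ z, |(∑' x, lx κ₁ x * Kf x z κ₁ κ₂) - lx κ₁ u * ∑' x, Kf x z κ₁ κ₂|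
        ≤ (ql * B * (2 / (m - κ) * Zl (d + 1) ((m - κ) / 2))) * Real.exp (-m * l1 (z - u)) := by
      intro z
      refine (abs_xlayer_sub_frozen_le hm hκ hpl hql hK hl hl' z κ₁ κ₂).trans (le_of_eq ?_); ring
    have hb := abs_tsum_le_tsum_of_abs_le hpt ((summable_exp_shift' hm0 u).mul_left _)
    refine hb.trans (le_of_eq ?_)
    rw [tsum_mul_left, tsum_exp_shift']
  -- (iv) Fubini for the charge
  have hF : ∀ κ₁ κ₂, (∑' z, ∑' x, Kf x z κ₁ κ₂) = ∑' x, ∑' z, Kf x z κ₁ κ₂ := by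
    intro κ₁ κ₂
    refine tsum_comm_of_prodBound ⟨fun z => B * Real.exp (-m * l1 (z - u)), fun x => Real.exp (-m * l1 (x - u)),
      (summable_exp_shift' hm0 u).mul_left B, summable_exp_shift' hm0 u, fun z => by positivity, fun x => (Real.exp_pos _).le,
      fun z x => absK_le hK x z κ₁ κ₂⟩
  -- assemble: `T0 − FROZ = Σ_{κ₂} [(ii)-remainder] + Σ_{κ₂} rz κ₂ u · Σ_{κ₁} [(iii)-remainder]`
  rw [hT0]
  have hsplit : (∑ κ₂ : Fin (d + 1), ∑' z, rz κ₂ z * G z κ₂)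
      - ∑ κ₂ : Fin (d + 1), ∑ κ₁ : Fin (d + 1), lx κ₁ u * rz κ₂ u * ∑' x, ∑' z, Kf x z κ₁ κ₂
      = ∑ κ₂ : Fin (d + 1), ((∑' z, rz κ₂ z * G z κ₂) - rz κ₂ u * ∑' z, G z κ₂)
        + ∑ κ₂ : Fin (d + 1), rz κ₂ u * ∑ κ₁ : Fin (d + 1),
            ((∑' z, ∑' x, lx κ₁ x * Kf x z κ₁ κ₂) - lx κ₁ u * ∑' z, ∑' x, Kf x z κ₁ κ₂) := by
    rw [← Finset.sum_sub_distrib, ← Finset.sum_add_distrib]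
    refine Finset.sum_congr rfl fun κ₂ _ => ?_
    have e4 : ∑ κ₁ : Fin (d + 1), lx κ₁ u * rz κ₂ u * ∑' x, ∑' z, Kf x z κ₁ κ₂
        = rz κ₂ u * ∑ κ₁ : Fin (d + 1), lx κ₁ u * ∑' z, ∑' x, Kf x z κ₁ κ₂ := by
      rw [Finset.mul_sum]
      exact Finset.sum_congr rfl fun κ₁ _ => by rw [hF κ₁ κ₂]; ring
    rw [e4, hGz κ₂, Finset.sum_sub_distrib]
    ring
  rw [hsplit]
  calc |∑ κ₂ : Fin (d + 1), ((∑' z, rz κ₂ z * G z κ₂) - rz κ₂ u * ∑' z, G z κ₂)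
        + ∑ κ₂ : Fin (d + 1), rz κ₂ u * ∑ κ₁ : Fin (d + 1),
            ((∑' z, ∑' x, lx κ₁ x * Kf x z κ₁ κ₂) - lx κ₁ u * ∑' z, ∑' x, Kf x z κ₁ κ₂)|
      ≤ ∑ κ₂ : Fin (d + 1), |(∑' z, rz κ₂ z * G z κ₂) - rz κ₂ u * ∑' z, G z κ₂|
        + ∑ κ₂ : Fin (d + 1), |rz κ₂ u * ∑ κ₁ : Fin (d + 1),
            ((∑' z, ∑' x, lx κ₁ x * Kf x z κ₁ κ₂) - lx κ₁ u * ∑' z, ∑' x, Kf x z κ₁ κ₂)| :=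
        (abs_add_le _ _).trans (add_le_add (Finset.abs_sum_le_sum_abs _ _) (Finset.abs_sum_le_sum_abs _ _))
    _ ≤ ∑ _κ₂ : Fin (d + 1), qr * 1 * BG * (2 / (m - κ) * Zl (d + 1) ((m - κ) / 2))
        + ∑ _κ₂ : Fin (d + 1), pr * (((d : ℝ) + 1) * (ql * B * (2 / (m - κ) * Zl (d + 1) ((m - κ) / 2)) * Zl (d + 1) m)) := by
        refine add_le_add (Finset.sum_le_sum fun κ₂ _ => hC κ₂) (Finset.sum_le_sum fun κ₂ _ => ?_)
        rw [abs_mul]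
        have hru : |rz κ₂ u| ≤ pr := by
          have h := hr κ₂ u; rwa [sub_self, show l1 (0 : Fin (d + 1) → ℤ) = 0 by simp [l1], mul_zero, Real.exp_zero, mul_one] at h
        refine mul_le_mul hru ?_ (abs_nonneg _) hpr
        calc |∑ κ₁ : Fin (d + 1), ((∑' z, ∑' x, lx κ₁ x * Kf x z κ₁ κ₂) - lx κ₁ u * ∑' z, ∑' x, Kf x z κ₁ κ₂)|
            ≤ ∑ κ₁ : Fin (d + 1), |(∑' z, ∑' x, lx κ₁ x * Kf x z κ₁ κ₂) - lx κ₁ u * ∑' z, ∑' x, Kf x z κ₁ κ₂| :=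
              Finset.abs_sum_le_sum_abs _ _
          _ ≤ ∑ _κ₁ : Fin (d + 1), ql * B * (2 / (m - κ) * Zl (d + 1) ((m - κ) / 2)) * Zl (d + 1) m :=
              Finset.sum_le_sum fun κ₁ _ => hB' κ₁ κ₂
          _ = _ := by simp only [Finset.sum_const, Finset.card_univ, Fintype.card_fin, nsmul_eq_mul]; push_cast; ring
    _ = _ := by
        simp only [Finset.sum_const, Finset.card_univ, Fintype.card_fin, nsmul_eq_mul, hBG]
        push_cast
        ring

include hm hpl hpr hK hl hr in
/-- [folklore] **SIZE OF THE SANDWICH**: `|Σ'_z Σ_{κ₂} (Σ'_x Σ_{κ₁} lx·K)·rz| ≤ (d+1)²·pr·pl·B·Zl(m−κ)²`. -/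
theorem abs_sand_le :
    |∑' z, ∑ κ₂ : Fin (d + 1), (∑' x, ∑ κ₁ : Fin (d + 1), lx κ₁ x * K x z (Sum.inl κ₁) (Sum.inl κ₂)) * rz κ₂ z|
      ≤ ((d : ℝ) + 1) ^ 2 * pr * pl * B * Zl (d + 1) (m - κ) ^ 2 := by
  have hmk : 0 < m - κ := sub_pos.2 hm
  have hZ1 : 0 ≤ Zl (d + 1) (m - κ) := Zl_nonneg hmk
  set G : (Fin (d + 1) → ℤ) → Fin (d + 1) → ℝ :=
    fun z κ₂ => ∑ κ₁ : Fin (d + 1), ∑' x, lx κ₁ x * K x z (Sum.inl κ₁) (Sum.inl κ₂) with hG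
  set BG : ℝ := ((d : ℝ) + 1) * (pl * B * Zl (d + 1) (m - κ)) with hBG
  have hGle : ∀ z κ₂, |G z κ₂| ≤ BG * Real.exp (-m * l1 (z - u)) := fun z κ₂ => abs_G_le hm hpl hK hl z κ₂
  have hx : ∀ z κ₂, (∑' x, ∑ κ₁ : Fin (d + 1), lx κ₁ x * K x z (Sum.inl κ₁) (Sum.inl κ₂)) = G z κ₂ := by
    intro z κ₂
    rw [hG]
    exact Summable.tsum_finsetSum fun κ₁ _ => (abs_xlayer_le hm hpl hK hl z κ₁ κ₂).1
  have hzs : ∀ κ₂, Summable fun z => rz κ₂ z * G z κ₂ := fun κ₂ =>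
    summable_mul_of_env (u := u) hm hpr zero_le_one (fun z => by rw [mul_one]; exact hr κ₂ z) (hGle · κ₂)
  have hzb : ∀ κ₂, |∑' z, rz κ₂ z * G z κ₂| ≤ pr * 1 * BG * Zl (d + 1) (m - κ) := fun κ₂ =>
    abs_tsum_mul_le_of_env (u := u) hm hpr zero_le_one (fun z => by rw [mul_one]; exact hr κ₂ z) (hGle · κ₂)
  have e : ∀ z, (∑ κ₂ : Fin (d + 1), (∑' x, ∑ κ₁ : Fin (d + 1), lx κ₁ x * K x z (Sum.inl κ₁) (Sum.inl κ₂)) * rz κ₂ z)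
      = ∑ κ₂ : Fin (d + 1), rz κ₂ z * G z κ₂ := fun z => Finset.sum_congr rfl fun κ₂ _ => by rw [hx z κ₂, mul_comm]
  rw [tsum_congr e, Summable.tsum_finsetSum fun κ₂ _ => hzs κ₂]
  calc |∑ κ₂ : Fin (d + 1), ∑' z, rz κ₂ z * G z κ₂| ≤ ∑ κ₂ : Fin (d + 1), |∑' z, rz κ₂ z * G z κ₂| := Finset.abs_sum_le_sum_abs _ _
    _ ≤ ∑ _κ₂ : Fin (d + 1), pr * 1 * BG * Zl (d + 1) (m - κ) := Finset.sum_le_sum fun κ₂ _ => hzb κ₂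
    _ = _ := by
        simp only [Finset.sum_const, Finset.card_univ, Fintype.card_fin, nsmul_eq_mul, hBG]
        push_cast
        ring

include hm hκ hpl hpr hK hl hr in
/-- [folklore] **SIZE OF THE FROZEN CHARGE TERM**: `|Σ_{κ₂ κ₁} lx κ₁ u·rz κ₂ u·Σ'_x Σ'_z K x z κ₁ κ₂| ≤ (d+1)²·pl·pr·B·(Zl m)²`. -/
theorem abs_frozen_le :
    |∑ κ₂ : Fin (d + 1), ∑ κ₁ : Fin (d + 1), lx κ₁ u * rz κ₂ u * ∑' x, ∑' z, K x z (Sum.inl κ₁) (Sum.inl κ₂)|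
      ≤ ((d : ℝ) + 1) ^ 2 * pl * pr * B * Zl (d + 1) m ^ 2 := by
  have hm0 : 0 < m := hκ.trans_lt hm
  have hZm : 0 ≤ Zl (d + 1) m := Zl_nonneg hm0
  have hlu : ∀ κ₁, |lx κ₁ u| ≤ pl := fun κ₁ => by
    have h := hl κ₁ u; rwa [sub_self, show l1 (0 : Fin (d + 1) → ℤ) = 0 by simp [l1], mul_zero, Real.exp_zero, mul_one] at h
  have hru : ∀ κ₂, |rz κ₂ u| ≤ pr := fun κ₂ => by
    have h := hr κ₂ u; rwa [sub_self, show l1 (0 : Fin (d + 1) → ℤ) = 0 by simp [l1], mul_zero, Real.exp_zero, mul_one] at h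
  have hKz : ∀ x κ₁ κ₂, |∑' z, K x z (Sum.inl κ₁) (Sum.inl κ₂)| ≤ (B * Zl (d + 1) m) * Real.exp (-m * l1 (x - u)) := by
    intro x κ₁ κ₂
    have hpt : ∀ z, |K x z (Sum.inl κ₁) (Sum.inl κ₂)| ≤ (B * Real.exp (-m * l1 (x - u))) * Real.exp (-m * l1 (z - u)) := by
      intro z; refine (hK x z κ₁ κ₂).trans (le_of_eq ?_); rw [mul_add, Real.exp_add]; ring
    have hb := abs_tsum_le_tsum_of_abs_le hpt ((summable_exp_shift' hm0 u).mul_left _)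
    refine hb.trans (le_of_eq ?_)
    rw [tsum_mul_left, tsum_exp_shift']; ring
  have hKxz : ∀ κ₁ κ₂, |∑' x, ∑' z, K x z (Sum.inl κ₁) (Sum.inl κ₂)| ≤ B * Zl (d + 1) m ^ 2 := by
    intro κ₁ κ₂
    have hb := abs_tsum_le_tsum_of_abs_le (fun x => hKz x κ₁ κ₂) ((summable_exp_shift' hm0 u).mul_left _)
    refine hb.trans (le_of_eq ?_)
    rw [tsum_mul_left, tsum_exp_shift']; ring
  calc |∑ κ₂ : Fin (d + 1), ∑ κ₁ : Fin (d + 1), lx κ₁ u * rz κ₂ u * ∑' x, ∑' z, K x z (Sum.inl κ₁) (Sum.inl κ₂)|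
      ≤ ∑ κ₂ : Fin (d + 1), ∑ κ₁ : Fin (d + 1), |lx κ₁ u * rz κ₂ u * ∑' x, ∑' z, K x z (Sum.inl κ₁) (Sum.inl κ₂)| :=
        (Finset.abs_sum_le_sum_abs _ _).trans (Finset.sum_le_sum fun κ₂ _ => Finset.abs_sum_le_sum_abs _ _)
    _ ≤ ∑ _κ₂ : Fin (d + 1), ∑ _κ₁ : Fin (d + 1), pl * pr * (B * Zl (d + 1) m ^ 2) := by
        refine Finset.sum_le_sum fun κ₂ _ => Finset.sum_le_sum fun κ₁ _ => ?_
        rw [abs_mul, abs_mul]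
        exact mul_le_mul (mul_le_mul (hlu κ₁) (hru κ₂) (abs_nonneg _) hpl) (hKxz κ₁ κ₂) (abs_nonneg _) (by positivity)
    _ = _ := by
        simp only [Finset.sum_const, Finset.card_univ, Fintype.card_fin, nsmul_eq_mul]
        push_cast
        ring

end Sandwich


end Summit.QuantumFields.BalabanUV.Beta.GAN24.LayerPushFrozenSlice

end
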